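import Summits.ABC.ABC.Theses.IneffectiveSubspace

/-!
# The converse of the transfer: the crux `TowerFourSubLiouville` implies a uniform binomial quartic saving

Helper (`--supports`) for the crux `Summit.ABC.ABC.Theses.IneffectiveSubspace.TowerFourSubLiouville`
(stmt-ABC-1649), line `fourth-radical-binomial-thue` (lead prover-line-stmt-ABC-1649-0, 2026-08-16).

The line proves the crux from `UBQ η` ("uniform binomial quartic": for `Z ≥ Z₀`, `v, w, Y > 0`,
`gcd(vY, wZ) = 1`, `max(v,w) ≤ Z^η`, `wZ⁴ ≠ vY⁴` one has `|wZ⁴ − vY⁴| > Z^η`) for SOME `η > 0`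
(`stub_transfer`).  This file proves the CONVERSE, `ubq_of_towerFourSubLiouville`: the crux implies `UBQ η` for some
`η > 0`.  Hence the line's transferred statement `∃ η > 0, UBQ η` is an honest EQUIVALENT of the crux, and — once the
Roth stratum `stub_fixedFormsRoth` (a theorem) is in — the line's residual core `stub_genericFormsSaving` is
crux-equivalent, which is the certificate the planners need if the core is promoted.

Proof.  Let `A < 2` and put `ε := max ((2 - A)/2) (1 - A) > 0`, `s := A + ε ∈ [1, 2)`, `δ := 2 - s ∈ (0, 1]`,
`η := δ / 8`.  Let `C` be the constant of `TowerIneq(4, s)`.  If `(v, w, Y, Z)` violated the saving, put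
`a := |wZ⁴ − vY⁴| ∈ [1, Z^η]`.  If `vY⁴ < wZ⁴` the tower point `x = (a,1,1,1)`, `y = (v,1,1,Y)`, `z = (w,1,1,Z)` is positive,
satisfies `a + vY⁴ = wZ⁴`, is coprime, and has `c = wZ⁴ ≥ Z⁴`, `Π = a v w Y Z` with `Π⁴ ≤ Z^{12η} · (Z^η Z⁴) · Z⁴`;
if `wZ⁴ < vY⁴` the mirrored point `x = (a,1,1,1)`, `y = (w,1,1,Z)`, `z = (v,1,1,Y)` has `c = vY⁴ > Z⁴` and
`Π⁴ ≤ Z^{12η} · 2Z^{4+η} · Z⁴`.  In both cases `c⁴ < C⁴ Π^{4s}` gives `Z^{16} < 2² C⁴ Z^{s(8+13η)} ≤ 4C⁴ Z^{16 − 2δ}`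
(as `s(8 + 13η) = (2 − δ)(8 + 13δ/8) ≤ 16 − 2δ`), i.e. `Z^{2δ} < 4C⁴`, impossible for `Z ≥ Z₀ := ⌈(4C⁴)^{1/(2δ)}⌉₊ + 1`.
-/

-- `Summit.ABC.ABC` is the mandated summit-side namespace (CONVENTIONS §2); the duplicate is deliberate.
set_option linter.dupNamespace false

namespace Summit.ABC.ABC.Theorems.TowerFourSubLiouville

open scoped BigOperators
open Summit.ABC.ABC.Theses.IneffectiveSubspace

/-- The level-4 tower data of the point `x = (p,1,1,1)`, `y = (q,1,1,Q)`, `z = (r,1,1,R)`: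
the three weighted products and `Π`. -/
theorem tower_point_eval (p q r Q R : ℕ) :
    (∏ i : Fin 4, (![p, 1, 1, 1] : Fin 4 → ℕ) i ^ (i.val + 1)) = p ∧
    (∏ i : Fin 4, (![q, 1, 1, Q] : Fin 4 → ℕ) i ^ (i.val + 1)) = q * Q ^ 4 ∧
    (∏ i : Fin 4, (![r, 1, 1, R] : Fin 4 → ℕ) i ^ (i.val + 1)) = r * R ^ 4 ∧
    (∏ i : Fin 4, (![p, 1, 1, 1] : Fin 4 → ℕ) i * (![q, 1, 1, Q] : Fin 4 → ℕ) i * (![r, 1, 1, R] : Fin 4 → ℕ) i)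
      = p * q * r * (Q * R) := by
  simp only [Fin.prod_univ_four]
  simp

end Summit.ABC.ABC.Theorems.TowerFourSubLiouville

namespace Summit.ABC.ABC.Theorems.TowerFourSubLiouville

open scoped BigOperators
open Summit.ABC.ABC.Theses.IneffectiveSubspace

/-- The analytic core of the converse: with `s ∈ [1,2)`, `δ = 2 − s`, `η = δ/8`, a point with
`Z⁴ ≤ c < C·Π^s` and `Π⁴ ≤ 2 Z^{8+13η}` forces `Z^{2δ} < 4C⁴`, impossible once `Z ≥ (4C⁴)^{1/(2δ)}`. -/
theorem converse_core {C s δ η Zr c P : ℝ} (hC : 0 < C) (hs1 : 1 ≤ s) (hδ : δ = 2 - s) (hδ0 : 0 < δ)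
    (hη : η = δ / 8) (hZ : (4 * C ^ 4) ^ (1 / (2 * δ)) ≤ Zr) (hZ1 : 1 ≤ Zr) (hP : 0 ≤ P)
    (h1 : Zr ^ 4 ≤ c) (h2 : c < C * P ^ s) (h3 : P ^ 4 ≤ 2 * Zr ^ (8 + 13 * η)) : False := by
  have hZ0 : 0 < Zr := lt_of_lt_of_le one_pos hZ1
  have hc0 : 0 < c := lt_of_lt_of_le (by positivity) h1
  have hs0 : 0 ≤ s := le_trans zero_le_one hs1
  -- `c⁴ < C⁴ (P⁴)^s`
  have step1 : c ^ 4 < (C * P ^ s) ^ 4 := pow_lt_pow_left₀ h2 hc0.le (by norm_num)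
  have hPs4 : (P ^ s) ^ 4 = (P ^ 4) ^ s := by
    rw [← Real.rpow_natCast (P ^ s) 4, ← Real.rpow_mul hP, mul_comm, Real.rpow_mul hP,
      Real.rpow_natCast]
  have step2 : (P ^ 4) ^ s ≤ (2 * Zr ^ (8 + 13 * η)) ^ s := Real.rpow_le_rpow (by positivity) h3 hs0
  have hsplit : (2 * Zr ^ (8 + 13 * η)) ^ s = (2 : ℝ) ^ s * Zr ^ ((8 + 13 * η) * s) := by
    rw [Real.mul_rpow (by norm_num) (Real.rpow_nonneg hZ0.le _), Real.rpow_mul hZ0.le]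
  have h2s : (2 : ℝ) ^ s ≤ 4 := by
    have h := Real.rpow_le_rpow_of_exponent_le (x := (2 : ℝ)) (by norm_num) (show s ≤ 2 by linarith)
    have h22 : (2 : ℝ) ^ (2 : ℝ) = 4 := by norm_num
    linarith [h, h22]
  have hexp : (8 + 13 * η) * s ≤ 16 - 2 * δ := by
    rw [hη, show s = 2 - δ by linarith]
    nlinarith [sq_nonneg δ]
  have hZexp : Zr ^ ((8 + 13 * η) * s) ≤ Zr ^ (16 - 2 * δ) := Real.rpow_le_rpow_of_exponent_le hZ1 hexp
  -- so `c⁴ < 4 C⁴ Z^{16−2δ}`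
  have hup : c ^ 4 < 4 * C ^ 4 * Zr ^ (16 - 2 * δ) := by
    calc c ^ 4 < (C * P ^ s) ^ 4 := step1
      _ = C ^ 4 * (P ^ 4) ^ s := by rw [mul_pow, hPs4]
      _ ≤ C ^ 4 * ((2 : ℝ) ^ s * Zr ^ ((8 + 13 * η) * s)) := by
          rw [← hsplit]; exact mul_le_mul_of_nonneg_left step2 (by positivity)
      _ ≤ C ^ 4 * (4 * Zr ^ (16 - 2 * δ)) := by
          apply mul_le_mul_of_nonneg_left _ (by positivity)
          exact mul_le_mul h2s hZexp (Real.rpow_nonneg hZ0.le _) (by norm_num)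
      _ = 4 * C ^ 4 * Zr ^ (16 - 2 * δ) := by ring
  -- and `c⁴ ≥ Z^{16} = Z^{2δ} Z^{16−2δ}`
  have hlow : Zr ^ (2 * δ) * Zr ^ (16 - 2 * δ) ≤ c ^ 4 := by
    have h16 : Zr ^ (2 * δ) * Zr ^ (16 - 2 * δ) = (Zr ^ 4) ^ 4 := by
      rw [← Real.rpow_add hZ0, show 2 * δ + (16 - 2 * δ) = ((16 : ℕ) : ℝ) by push_cast; ring,
        Real.rpow_natCast]
      ring
    rw [h16]
    exact pow_le_pow_left₀ (by positivity) h1 4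
  have hkey : Zr ^ (2 * δ) < 4 * C ^ 4 := by
    have hpos : 0 < Zr ^ (16 - 2 * δ) := Real.rpow_pos_of_pos hZ0 _
    nlinarith [hlow, hup, hpos]
  -- but `Z ≥ (4C⁴)^{1/(2δ)}` gives `Z^{2δ} ≥ 4C⁴`
  have hge : 4 * C ^ 4 ≤ Zr ^ (2 * δ) := by
    have h := Real.rpow_le_rpow (by positivity) hZ (show 0 ≤ 2 * δ by linarith)
    rwa [← Real.rpow_mul (by positivity), show 1 / (2 * δ) * (2 * δ) = 1 by field_simp,
      Real.rpow_one] at h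
  linarith

/-- Exponent bookkeeping for `Π⁴` of the enemy point: `(Z^η)⁴·(Z^η)⁴·(Z^η)⁴·Z⁴·(2 Z^η Z⁴) = 2 Z^{8+13η}`. -/
theorem converse_rpow_bookkeeping {Zr : ℝ} (hZ : 0 < Zr) (η : ℝ) :
    (Zr ^ η) ^ 4 * (Zr ^ η) ^ 4 * (Zr ^ η) ^ 4 * Zr ^ 4 * (2 * Zr ^ η * Zr ^ 4) = 2 * Zr ^ (8 + 13 * η) := by
  have h4 : ∀ t : ℝ, (Zr ^ t) ^ 4 = Zr ^ (t * 4) := fun t => by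
    rw [← Real.rpow_natCast (Zr ^ t) 4, ← Real.rpow_mul hZ.le]; norm_num
  have hZ4 : Zr ^ 4 = Zr ^ (4 : ℝ) := by rw [← Real.rpow_natCast]; norm_num
  rw [h4, hZ4]
  have key : Zr ^ (8 + 13 * η) = Zr ^ (η * 4) * Zr ^ (η * 4) * Zr ^ (η * 4) * Zr ^ (4 : ℝ) * (Zr ^ η * Zr ^ (4 : ℝ)) := by
    simp only [← Real.rpow_add hZ]
    congr 1; ring
  rw [key]; ring

/-- **The converse of the line's transfer** (`CruxGivesUBQ` of the skeleton, unfolded): the crux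
`TowerFourSubLiouville` implies the uniform binomial quartic saving `UBQ η` for some `η > 0` — for `Z ≥ Z₀`,
`v, w, Y > 0`, `gcd(vY, wZ) = 1`, `max(v,w) ≤ Z^η` and `wZ⁴ ≠ vY⁴` one has `|wZ⁴ − vY⁴| > Z^η`.  Together with
`stub_transfer` this makes `∃ η > 0, UBQ η` an EQUIVALENT of the crux (so the line's core stub is crux-equivalent
modulo the Roth stratum).  Proof: an enemy `(v,w,Y,Z)` is the tower point `x = (a,1,1,1)`, `y = (v,1,1,Y)`,
`z = (w,1,1,Z)` (or its mirror), with `c ≥ Z⁴` and `Π⁴ ≤ 2Z^{8+13η}`; see the module docstring. -/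
theorem ubq_of_towerFourSubLiouville (h : TowerFourSubLiouville) :
    ∃ η : ℝ, 0 < η ∧ ∃ Z₀ : ℕ, ∀ v w Y Z : ℕ, Z₀ ≤ Z → 0 < v → 0 < w → 0 < Y → Nat.Coprime (v * Y) (w * Z) →
      ((max v w : ℕ) : ℝ) ≤ (Z : ℝ) ^ η → w * Z ^ 4 ≠ v * Y ^ 4 →
      (Z : ℝ) ^ η < |((w * Z ^ 4 : ℕ) : ℝ) - ((v * Y ^ 4 : ℕ) : ℝ)| := by
  obtain ⟨A, hA2, hT⟩ := h
  set ε : ℝ := max ((2 - A) / 2) (1 - A) with hεdef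
  have hε : 0 < ε := lt_max_of_lt_left (by linarith)
  have hεlt : ε < 2 - A := max_lt (by linarith) (by linarith)
  obtain ⟨C, hC, hineq⟩ := hT ε hε
  have hs1 : 1 ≤ A + ε := by
    have := le_max_right ((2 - A) / 2) (1 - A); linarith
  set δ : ℝ := 2 - (A + ε) with hδdef
  have hδ0 : 0 < δ := by linarith
  refine ⟨δ / 8, by linarith, ⌈(4 * C ^ 4) ^ (1 / (2 * δ))⌉₊ + 1, ?_⟩
  intro v w Y Z hZ hv hw hY hcop hmax hne
  have hZ1 : 1 ≤ Z := by omega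
  have hZpos : 0 < Z := by omega
  have hZr1 : (1 : ℝ) ≤ Z := by exact_mod_cast hZ1
  have hZr0 : (0 : ℝ) < Z := by exact_mod_cast hZpos
  have hZr : (4 * C ^ 4) ^ (1 / (2 * δ)) ≤ (Z : ℝ) := by
    have h1 : (⌈(4 * C ^ 4) ^ (1 / (2 * δ))⌉₊ : ℝ) ≤ (Z : ℝ) := by exact_mod_cast (by omega : ⌈(4 * C ^ 4) ^ (1 / (2 * δ))⌉₊ ≤ Z)
    exact le_trans (Nat.le_ceil _) h1
  by_contra hcon
  rw [not_lt] at hcon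
  -- the two small coefficients
  have hvle : (v : ℝ) ≤ (Z : ℝ) ^ (δ / 8) := le_trans (by exact_mod_cast le_max_left v w) hmax
  have hwle : (w : ℝ) ≤ (Z : ℝ) ^ (δ / 8) := le_trans (by exact_mod_cast le_max_right v w) hmax
  have hη4 : (1 : ℝ) ≤ (Z : ℝ) ^ 4 := one_le_pow₀ hZr1
  have hηpos : (0 : ℝ) ≤ (Z : ℝ) ^ (δ / 8) := Real.rpow_nonneg hZr0.le _
  -- coprimality of the two quartic terms
  have hcop4 : Nat.Coprime (v * Y ^ 4) (w * Z ^ 4) :=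
    Nat.Coprime.coprime_dvd_left ⟨v ^ 3, by ring⟩
      (Nat.Coprime.coprime_dvd_right ⟨w ^ 3, by ring⟩ (Nat.Coprime.pow 4 4 hcop))
  rcases lt_or_gt_of_ne hne with hlt | hgt
  · -- `wZ⁴ < vY⁴`: the mirrored point, `c = vY⁴`
    set a := v * Y ^ 4 - w * Z ^ 4 with hadef
    have ha : a + w * Z ^ 4 = v * Y ^ 4 := Nat.sub_add_cancel hlt.le
    have ha0 : 0 < a := Nat.sub_pos_of_lt hlt
    have hcast : ((v * Y ^ 4 : ℕ) : ℝ) = (a : ℝ) + ((w * Z ^ 4 : ℕ) : ℝ) := by exact_mod_cast ha.symm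
    have habs : |((w * Z ^ 4 : ℕ) : ℝ) - ((v * Y ^ 4 : ℕ) : ℝ)| = (a : ℝ) := by
      rw [hcast, show ((w * Z ^ 4 : ℕ) : ℝ) - ((a : ℝ) + ((w * Z ^ 4 : ℕ) : ℝ)) = -(a : ℝ) by ring, abs_neg,
        abs_of_nonneg (Nat.cast_nonneg a)]
    have hale : (a : ℝ) ≤ (Z : ℝ) ^ (δ / 8) := by rw [← habs]; exact hcon
    have hcopa : Nat.Coprime a (w * Z ^ 4) := Nat.coprime_add_self_left.mp (by rw [ha]; exact hcop4)
    obtain ⟨e1, e2, e3, e4⟩ := tower_point_eval a w v Z Y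
    have hpos' : ∀ i : Fin 4, 0 < (![a, 1, 1, 1] : Fin 4 → ℕ) i ∧ 0 < (![w, 1, 1, Z] : Fin 4 → ℕ) i ∧
        0 < (![v, 1, 1, Y] : Fin 4 → ℕ) i := by
      intro i; fin_cases i <;> simp [ha0, hv, hw, hY, hZpos]
    have heq' : (∏ i : Fin 4, (![a, 1, 1, 1] : Fin 4 → ℕ) i ^ (i.val + 1)) +
        (∏ i : Fin 4, (![w, 1, 1, Z] : Fin 4 → ℕ) i ^ (i.val + 1)) =
        ∏ i : Fin 4, (![v, 1, 1, Y] : Fin 4 → ℕ) i ^ (i.val + 1) := by rw [e1, e2, e3]; exact ha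
    have hcop' : Nat.Coprime (∏ i : Fin 4, (![a, 1, 1, 1] : Fin 4 → ℕ) i ^ (i.val + 1))
        (∏ i : Fin 4, (![w, 1, 1, Z] : Fin 4 → ℕ) i ^ (i.val + 1)) := by rw [e1, e2]; exact hcopa
    have hpt := hineq _ _ _ hpos' heq' hcop'
    rw [e3, e4] at hpt
    have h1 : (Z : ℝ) ^ 4 ≤ ((v * Y ^ 4 : ℕ) : ℝ) := by
      exact_mod_cast (le_trans (Nat.le_mul_of_pos_left (Z ^ 4) hw) hlt.le)
    have hY4 : ((Y : ℝ)) ^ 4 ≤ 2 * (Z : ℝ) ^ (δ / 8) * (Z : ℝ) ^ 4 := by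
      have hnat : Y ^ 4 ≤ v * Y ^ 4 := Nat.le_mul_of_pos_left (Y ^ 4) hv
      have hr : ((Y : ℝ)) ^ 4 ≤ (a : ℝ) + (w : ℝ) * (Z : ℝ) ^ 4 := by
        have := (Nat.cast_le (α := ℝ)).mpr hnat
        rw [hcast] at this; push_cast at this; linarith
      have hwZ : (w : ℝ) * (Z : ℝ) ^ 4 ≤ (Z : ℝ) ^ (δ / 8) * (Z : ℝ) ^ 4 :=
        mul_le_mul_of_nonneg_right hwle (by positivity)
      have ha' : (a : ℝ) ≤ (Z : ℝ) ^ (δ / 8) * (Z : ℝ) ^ 4 := by nlinarith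
      linarith
    have h3 : (((a * w * v * (Z * Y) : ℕ) : ℝ)) ^ 4 ≤ 2 * (Z : ℝ) ^ (8 + 13 * (δ / 8)) := by
      rw [← converse_rpow_bookkeeping hZr0 (δ / 8)]
      push_cast
      have : ((a : ℝ) * w * v * (Z * Y)) ^ 4 = (a : ℝ) ^ 4 * (w : ℝ) ^ 4 * (v : ℝ) ^ 4 * (Z : ℝ) ^ 4 * (Y : ℝ) ^ 4 := by ring
      rw [this]
      gcongr
    exact converse_core hC hs1 rfl hδ0 rfl hZr hZr1 (Nat.cast_nonneg _) h1 hpt h3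
  · -- `vY⁴ < wZ⁴`: the point itself, `c = wZ⁴`
    set a := w * Z ^ 4 - v * Y ^ 4 with hadef
    have ha : a + v * Y ^ 4 = w * Z ^ 4 := Nat.sub_add_cancel hgt.le
    have ha0 : 0 < a := Nat.sub_pos_of_lt hgt
    have hcast : ((w * Z ^ 4 : ℕ) : ℝ) = (a : ℝ) + ((v * Y ^ 4 : ℕ) : ℝ) := by exact_mod_cast ha.symm
    have habs : |((w * Z ^ 4 : ℕ) : ℝ) - ((v * Y ^ 4 : ℕ) : ℝ)| = (a : ℝ) := by
      rw [hcast, show (a : ℝ) + ((v * Y ^ 4 : ℕ) : ℝ) - ((v * Y ^ 4 : ℕ) : ℝ) = (a : ℝ) by ring,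
        abs_of_nonneg (Nat.cast_nonneg a)]
    have hale : (a : ℝ) ≤ (Z : ℝ) ^ (δ / 8) := by rw [← habs]; exact hcon
    have hcopa : Nat.Coprime a (v * Y ^ 4) := Nat.coprime_add_self_left.mp (by rw [ha]; exact hcop4.symm)
    obtain ⟨e1, e2, e3, e4⟩ := tower_point_eval a v w Y Z
    have hpos' : ∀ i : Fin 4, 0 < (![a, 1, 1, 1] : Fin 4 → ℕ) i ∧ 0 < (![v, 1, 1, Y] : Fin 4 → ℕ) i ∧
        0 < (![w, 1, 1, Z] : Fin 4 → ℕ) i := by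
      intro i; fin_cases i <;> simp [ha0, hv, hw, hY, hZpos]
    have heq' : (∏ i : Fin 4, (![a, 1, 1, 1] : Fin 4 → ℕ) i ^ (i.val + 1)) +
        (∏ i : Fin 4, (![v, 1, 1, Y] : Fin 4 → ℕ) i ^ (i.val + 1)) =
        ∏ i : Fin 4, (![w, 1, 1, Z] : Fin 4 → ℕ) i ^ (i.val + 1) := by rw [e1, e2, e3]; exact ha
    have hcop' : Nat.Coprime (∏ i : Fin 4, (![a, 1, 1, 1] : Fin 4 → ℕ) i ^ (i.val + 1))
        (∏ i : Fin 4, (![v, 1, 1, Y] : Fin 4 → ℕ) i ^ (i.val + 1)) := by rw [e1, e2]; exact hcopa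
    have hpt := hineq _ _ _ hpos' heq' hcop'
    rw [e3, e4] at hpt
    have h1 : (Z : ℝ) ^ 4 ≤ ((w * Z ^ 4 : ℕ) : ℝ) := by
      exact_mod_cast (Nat.le_mul_of_pos_left (Z ^ 4) hw)
    have hY4 : ((Y : ℝ)) ^ 4 ≤ 2 * (Z : ℝ) ^ (δ / 8) * (Z : ℝ) ^ 4 := by
      have hnat : Y ^ 4 ≤ w * Z ^ 4 := le_trans (Nat.le_mul_of_pos_left (Y ^ 4) hv) hgt.le
      have hr : ((Y : ℝ)) ^ 4 ≤ (w : ℝ) * (Z : ℝ) ^ 4 := by exact_mod_cast hnat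
      have hwZ : (w : ℝ) * (Z : ℝ) ^ 4 ≤ (Z : ℝ) ^ (δ / 8) * (Z : ℝ) ^ 4 :=
        mul_le_mul_of_nonneg_right hwle (by positivity)
      nlinarith
    have h3 : (((a * v * w * (Y * Z) : ℕ) : ℝ)) ^ 4 ≤ 2 * (Z : ℝ) ^ (8 + 13 * (δ / 8)) := by
      rw [← converse_rpow_bookkeeping hZr0 (δ / 8)]
      push_cast
      have : ((a : ℝ) * v * w * (Y * Z)) ^ 4 = (a : ℝ) ^ 4 * (v : ℝ) ^ 4 * (w : ℝ) ^ 4 * (Z : ℝ) ^ 4 * (Y : ℝ) ^ 4 := by ring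
      rw [this]
      gcongr
    exact converse_core hC hs1 rfl hδ0 rfl hZr hZr1 (Nat.cast_nonneg _) h1 hpt h3

/-- Registered form (`stub_cruxGivesUBQ` on stmt-ABC-1649): the crux implies `∃ η > 0, UBQ η`
(= `ubq_of_towerFourSubLiouville`). -/
theorem stub_cruxGivesUBQ : Summit.ABC.ABC.Theses.IneffectiveSubspace.TowerFourSubLiouville → ∃ η : ℝ, 0 < η ∧ ∃ Z₀ : ℕ, ∀ v w Y Z : ℕ, Z₀ ≤ Z → 0 < v → 0 < w → 0 < Y → Nat.Coprime (v * Y) (w * Z) → ((max v w : ℕ) : ℝ) ≤ (Z : ℝ) ^ η → w * Z ^ 4 ≠ v * Y ^ 4 → (Z : ℝ) ^ η < |((w * Z ^ 4 : ℕ) : ℝ) - ((v * Y ^ 4 : ℕ) : ℝ)| :=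
  fun h => ubq_of_towerFourSubLiouville h

end Summit.ABC.ABC.Theorems.TowerFourSubLiouville
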